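import Literature.MathematicalPhysics.QuantumFieldTheory.Balaban1983to89.T4AdjointCovarianceUnitary
import Literature.MathematicalPhysics.QuantumFieldTheory.Balaban1983to89.Setup
import Literature.MathematicalPhysics.QuantumLattice.RepLieAlgebraUnitary

/-!
# `T4Continuum.ShellMeasureExpChartSUN` — the exponential block chart of `SU(N)`, general `N`, in orthonormal
# coordinates of `𝔰𝔲(N)`: generators, ray dictionary, block chart, star-shaped windows and cost-free chart weights
# (cell `pub-balaban`, sub-cell `t4`, spine estimate NE7c (node U5b); ROUND-2 crew `t4-ne7c-formalise-*`, row S3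
# «SM-L9 SU(N) chart» of the claim table `t4/b2b-balaban-t4-ne7c-p1/LEAVES-NE7c-P1.md` (trigger
# `t4/T4-NE7c-TRIGGER.json`, condition c5: optional and last — `SU(2)` is the row's certified instance); seat
# `b2b-balaban-t4-ne7c-formalise-leaf-04`; v1.1 = v1 (p208431) + §3 appended (the chart dimension in NUMBERS,
# `dimSU N = N² − 1`, by the tree's `RepLieAlgebraUnitary.finrank_skewAdjoint_inf_ker_trace`; one import added, all v1
# declarations byte-identical); v1.2 = v1.1 (p209873) + the cell's verbatim HONEST DEPENDENCY sentence in this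
# docstring (crew referee pass 10 DV-22; doc-only, every declaration byte-identical); file 1 of the row, consumed by
# `ShellMeasureScalingSUN` (the (CH) reduction and the realized engine); tree target
# `Summits/QuantumFields/BalabanUV/T4Continuum/Support/`; ADDITIVE — imports the tree's `T4AdjointCovarianceUnitary`
# (`lieSU`, `expSU`) and `Setup` (`GaugeField`) and modifies nothing)

HONEST FRAMING.  Finite four-torus programme, rung (B)+1 only — NOT infinite volume, NOT a mass gap, NOT the Clay
problem, NOT summit progress; (B), `BetaPertHyp`, (B^μ) are not mentioned because nothing here consumes them.  The
cell wall of NE7c — (M1) `T4ShellMeasure.SlotAntiConcentration` FOR BAŁABAN'S INDUCTIVELY DEFINED EFFECTIVE MEASURES —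
is NOT PRINTED in [Balaban 1983–89] (GAPS G-ne7cp1-1), asserted by nobody, and NOT moved by this file; a landed S3
changes NOTHING in the countdown (spine PROVED 0/9); NE7c NOT proved.  Every declaration is [folklore] kernel
mathematics (finite-dimensional linear algebra and the matrix exponential), 0 sorry, 0 citations, no `def … : Prop`.
HONEST DEPENDENCY (cell, verbatim): continuum YM on T⁴ ⇐ BetaPertH ∧ nine spine estimates (0/9 proved);
BetaPertH ⇐ (D1) ∧ (D4) ∧ CAP+tail; G-an2-4 gates asym, D1 and NE2/3/4.

THE POINTS.
* §1 THE EXPONENTIAL CHART OF `SU(N)`.  The chart space of ONE bond is the Euclidean coordinate space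
  `E_N = EuclideanSpace ℝ (Fin d_N)`, `d_N = dim_ℝ 𝔰𝔲(N)` (`dimSU`; only the symbol is used), identified with the
  tree's `T4AdjointCovarianceUnitary.lieSU (Fin N)` (trace-free skew-Hermitian matrices, Hilbert–Schmidt inner product
  `Re Tr X*Y`) by the ORTHONORMAL coordinates `coordSU = (stdOrthonormalBasis ℝ 𝔰𝔲(N)).repr⁻¹` (a linear isometry,
  `norm_genSU`); the generator `genSU v = coordSU v` is real-linear in the chart point (`genSU_smul`), skew-Hermitian
  (`genSU_mem_skewAdjoint`) and trace-free (`trace_genSU`), and the chart point `expPtSU v = exp (genSU v) ∈ SU(N)` is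
  the tree's `expSU` — so along every contraction ray the chart bond IS the word letter `exp ((c : ℂ) • genSU v)`
  (`coe_expPtSU_smul`): the dictionary of `ShellMeasureExpChartDictionary` (there for `SU(2)` through the
  quaternions) for general `N`, in the shape of the binders `hLu`/`hLw`/`hgood` of
  `ShellMeasureWilsonBlock.slotAntiConcentration_levelZero`.  The chart about `g` is `expChartSU g v = g · expPtSU v`;
  the BLOCK chart through the bonds `Λ` about `u₀` is `expFibreChartSU Λ u₀ x = (b ↦ u₀ b · expPtSU (x b))` on the
  block chart space `BlockChartSU N Λ = ↥Λ → E_N` (sup norm, product Lebesgue measure `volume`, dimension `#Λ · d_N`,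
  `finrank_blockChart`) — the convention of `T4CubeChartExp.expFibreChart`, WITHOUT a coordinate enumeration
  (the block chart space is already a product).
* §2 WINDOWS AND COST-FREE CHART WEIGHTS.  The chart-side window is the closed ball `‖x‖ ≤ S` of the block chart
  space (= the product of the one-bond balls, `closedBall_eq_pi`), STAR-SHAPED about the centre
  (`smul_mem_closedBall_zero`); for ANY one-bond weight `J₁` that does not decrease towards the centre on the ball
  (`J₁ v ≤ J₁ (c • v)`, `0 ≤ c ≤ 1`, `‖v‖ ≤ S`) the block chart weight `1_{‖x‖ ≤ S} · ∏_b J₁ (x b)` (`chartWeightSU`)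
  does not decrease along any contraction `x ↦ e^{−a} x`, `a ≥ 0` (`chartWeightSU_le_smul`) — the hypothesis `hJ` of
  `ShellMeasureScalingLocal.slotAntiConcentration_of_coreMap_mul`: such a weight rides free in (S-ii), exactly as the
  `SU(2)` Jacobian `∏_b (2π²)⁻¹ sinc²|x_b|` does in `ShellMeasureScalingSU2` §1.  (The `SU(N)` exponential Haar Jacobian
  `∏_{α>0} sinc²(α(X)/2)` IS such a weight on `‖X‖_HS ≤ π`; that is NOT used or asserted here — `J₁` stays a binder.)

WHAT THIS DOES NOT DO.  No measure identity is proved here (the chart identity (CH) is the business of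
`ShellMeasureScalingSUN`, where it is REDUCED to one bond and DISPLAYED, not asserted, for `N ≥ 3`); nothing of
Bałaban's is constructed; (Det), (FI-sat), (LR), (MR), (W1), the (F∞)-rate keep their status.  NE7c NOT proved.
-/

noncomputable section

namespace Summit.QuantumFields.BalabanUV.T4Continuum.ShellMeasureExpChartSUN

open MeasureTheory Set Function Metric
open scoped ENNReal
open Literature.MathematicalPhysics.QuantumFieldTheory.Balaban1983to89
open T4AdjointCovarianceUnitary (lieSU expSU mem_lieSU_iff coe_expSU)

variable {N : ℕ}

/-- `SU(N)` as a type (the tree's `Matrix.specialUnitaryGroup (Fin N) ℂ`; cf. `T4CubeChartGnomonic.SU2`). [folklore] -/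
abbrev SUN (N : ℕ) : Type := ↥(Matrix.specialUnitaryGroup (Fin N) ℂ)

/-! ## §1 The exponential chart of `SU(N)` in orthonormal coordinates of `𝔰𝔲(N)` -/

section Chart

/-- the chart dimension of one bond: `d_N = dim_ℝ 𝔰𝔲(N)` (`= N² − 1`; only the symbol is used). [folklore] -/
def dimSU (N : ℕ) : ℕ := Module.finrank ℝ (lieSU (Fin N))

/-- the ONE-BOND CHART SPACE `E_N = ℝ^{d_N}` with its Euclidean structure. [folklore] -/
abbrev ChartSU (N : ℕ) : Type := EuclideanSpace ℝ (Fin (dimSU N))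

/-- ORTHONORMAL COORDINATES of `𝔰𝔲(N)` (Hilbert–Schmidt inner product `Re Tr X*Y` of the tree's `lieSU`): the
inverse of the representation map of Mathlib's `stdOrthonormalBasis`, a linear isometry `E_N ≃ 𝔰𝔲(N)`. [folklore] -/
def coordSU : ChartSU N ≃ₗᵢ[ℝ] lieSU (Fin N) := (stdOrthonormalBasis ℝ (lieSU (Fin N))).repr.symm

/-- the GENERATOR of the chart point `v`: the trace-free skew-Hermitian matrix with coordinates `v`. [folklore] -/
def genSU (v : ChartSU N) : Matrix (Fin N) (Fin N) ℂ := (coordSU v : lieSU (Fin N))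

/-- the generator is skew-Hermitian and trace-free. [folklore] -/
theorem genSU_mem (v : ChartSU N) : star (genSU v) = -genSU v ∧ (genSU v).trace = 0 :=
  mem_lieSU_iff.mp (coordSU v).2

/-- the generator is SKEW-HERMITIAN: `genSU v ∈ skewAdjoint M_N(ℂ)` (so `Re Tr = 0` on it and its exponentials are
unitary — the admissibility `ShellMeasureWilsonBlock.good_gen_of_mem_skewAdjoint`). [folklore] -/
theorem genSU_mem_skewAdjoint (v : ChartSU N) : genSU v ∈ skewAdjoint (Matrix (Fin N) (Fin N) ℂ) :=
  skewAdjoint.mem_iff.mpr (genSU_mem v).1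

/-- the generator is trace-free. [folklore] -/
theorem trace_genSU (v : ChartSU N) : (genSU v).trace = 0 := (genSU_mem v).2

/-- the generator is REAL-LINEAR in the chart point: `genSU (c • v) = (c : ℂ) • genSU v` — the ray-linearity `hLu`
of the level-0 instance `ShellMeasureWilsonBlock.slotAntiConcentration_levelZero`. [folklore] -/
theorem genSU_smul (c : ℝ) (v : ChartSU N) : genSU (c • v) = (c : ℂ) • genSU v := by
  unfold genSU
  rw [LinearIsometryEquiv.map_smul, Submodule.coe_smul, RCLike.real_smul_eq_coe_smul (K := ℂ)]
  rfl

/-- the generator is additive in the chart point. [folklore] -/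
theorem genSU_add (v w : ChartSU N) : genSU (v + w) = genSU v + genSU w := by
  unfold genSU
  rw [LinearIsometryEquiv.map_add, Submodule.coe_add]

/-- `genSU 0 = 0`. [folklore] -/
theorem genSU_zero : genSU (0 : ChartSU N) = 0 := by
  unfold genSU
  rw [LinearIsometryEquiv.map_zero, Submodule.coe_zero]

/-- the generator has the Hilbert–Schmidt norm of the chart point: `‖genSU v‖_HS = ‖v‖` (Frobenius scope). [folklore] -/
theorem norm_genSU (v : ChartSU N) :
    ‖(coordSU v : lieSU (Fin N))‖ = ‖v‖ := (coordSU (N := N)).norm_map v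

/-- the generator depends continuously on the chart point. [folklore] -/
theorem continuous_genSU : Continuous (genSU (N := N)) :=
  continuous_subtype_val.comp (coordSU (N := N)).continuous

/-- THE ONE-BOND EXPONENTIAL CHART POINT `expPtSU v = exp (genSU v) ∈ SU(N)` (the tree's `expSU ∘ coordSU`).
[folklore] -/
def expPtSU (v : ChartSU N) : SUN N := expSU (coordSU v)

/-- `expPtSU v = exp (genSU v)` as matrices. [folklore] -/
@[simp] theorem coe_expPtSU (v : ChartSU N) :
    ((expPtSU v : SUN N) : Matrix (Fin N) (Fin N) ℂ) =
      NormedSpace.exp (genSU v) := rfl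

/-- **THE DICTIONARY** along rays: the scaled chart point is the exponential of the scaled generator,
`expPtSU (c • v) = exp ((c : ℂ) • genSU v)` — every chart bond IS a word letter `exp (c·Y)` with `Y` real-linear in
the chart point and skew-Hermitian (generalises `ShellMeasureExpChartDictionary.coe_expPt_smul` from `SU(2)`).
[folklore] -/
theorem coe_expPtSU_smul (c : ℝ) (v : ChartSU N) :
    ((expPtSU (c • v) : SUN N) : Matrix (Fin N) (Fin N) ℂ) =
      NormedSpace.exp ((c : ℂ) • genSU v) := by
  rw [coe_expPtSU, genSU_smul]

/-- the chart centre: `expPtSU 0 = 1`. [folklore] -/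
theorem expPtSU_zero : expPtSU (0 : ChartSU N) = 1 := by
  apply Subtype.ext
  rw [coe_expPtSU, genSU_zero, NormedSpace.exp_zero]
  rfl

/-- the chart point depends continuously on the chart coordinates. [folklore] -/
theorem continuous_expPtSU : Continuous (expPtSU (N := N)) := by
  refine Continuous.subtype_mk ?_ _
  open scoped Matrix.Norms.L2Operator in
  letI : NormedAlgebra ℚ (Matrix (Fin N) (Fin N) ℂ) := NormedAlgebra.restrictScalars ℚ ℂ _
  exact NormedSpace.exp_continuous.comp continuous_genSU

/-- the chart point depends measurably on the chart coordinates. [folklore] -/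
theorem measurable_expPtSU : Measurable (expPtSU (N := N)) := continuous_expPtSU.measurable

/-- THE EXPONENTIAL CHART ABOUT `g`: `v ↦ g · exp (genSU v)`. [folklore] -/
def expChartSU (g : SUN N) (v : ChartSU N) : SUN N :=
  g * expPtSU v

/-- `expChartSU g = (g * ·) ∘ expPtSU`. [folklore] -/
theorem expChartSU_eq_comp (g : SUN N) :
    expChartSU g = (fun h => g * h) ∘ expPtSU (N := N) := rfl

/-- the chart about `g` is continuous. [folklore] -/
theorem continuous_expChartSU (g : SUN N) : Continuous (expChartSU g) :=
  continuous_const.mul continuous_expPtSU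

/-- the chart about `g` is measurable. [folklore] -/
theorem measurable_expChartSU (g : SUN N) : Measurable (expChartSU g) :=
  (continuous_expChartSU g).measurable

end Chart

/-! ## §1b The block chart through the bonds `Λ` -/

section Block

variable {P : Params} {j : ℕ}

/-- THE BLOCK CHART SPACE through the bonds `Λ`: one Euclidean chart coordinate vector per bond (sup norm, product
Lebesgue measure `volume`). [folklore] -/
abbrev BlockChartSU (N : ℕ) (Λ : Finset (PBond P j)) : Type := ↥Λ → ChartSU N

/-- its dimension is `#Λ · d_N`. [folklore] -/
theorem finrank_blockChart (Λ : Finset (PBond P j)) :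
    Module.finrank ℝ (BlockChartSU N Λ) = Λ.card * dimSU N := by
  rw [Module.finrank_pi_fintype, Finset.sum_const, Finset.card_univ, Fintype.card_coe, smul_eq_mul,
    finrank_euclideanSpace_fin]

/-- **THE EXPONENTIAL BLOCK CHART** through `Λ` about `u₀`: `x ↦ (b ↦ u₀ b · exp (genSU (x b)))`. [folklore] -/
def expFibreChartSU (Λ : Finset (PBond P j)) (u₀ : GaugeField P j (SUN N))
    (x : BlockChartSU N Λ) : ↥Λ → SUN N :=
  fun b => expChartSU (u₀ b) (x b)

variable (Λ : Finset (PBond P j)) (u₀ : GaugeField P j (SUN N))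

/-- the block chart, bond by bond. [folklore] -/
@[simp] theorem expFibreChartSU_apply (x : BlockChartSU N Λ) (b : ↥Λ) :
    expFibreChartSU Λ u₀ x b = u₀ b * expPtSU (x b) := rfl

/-- along a contraction ray every bond of the block chart is `u₀ b · exp ((c : ℂ) • genSU (x b))`. [folklore] -/
theorem coe_expFibreChartSU_smul (c : ℝ) (x : BlockChartSU N Λ) (b : ↥Λ) :
    ((expFibreChartSU Λ u₀ (c • x) b : SUN N) : Matrix (Fin N) (Fin N) ℂ) =
      (u₀ b : Matrix (Fin N) (Fin N) ℂ) * NormedSpace.exp ((c : ℂ) • genSU (x b)) := by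
  rw [expFibreChartSU_apply, Pi.smul_apply, Submonoid.coe_mul, coe_expPtSU_smul]

/-- the block chart is continuous. [folklore] -/
theorem continuous_expFibreChartSU : Continuous (expFibreChartSU Λ u₀) :=
  continuous_pi fun b => (continuous_expChartSU (u₀ b)).comp (continuous_apply b)

/-- the block chart is measurable. [folklore] -/
theorem measurable_expFibreChartSU : Measurable (expFibreChartSU Λ u₀) :=
  (continuous_expFibreChartSU Λ u₀).measurable

end Block

/-! ## §2 Windows: the chart-side ball is star-shaped; centre-monotone one-bond weights give cost-free block weights -/

section Window

variable {P : Params} {j : ℕ} (Λ : Finset (PBond P j))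

/-- the chart-side window `‖x‖ ≤ S` of the block chart space is the product of the one-bond balls (`0 ≤ S`).
[folklore] -/
theorem closedBall_eq_pi {S : ℝ} (hS : 0 ≤ S) :
    closedBall (0 : BlockChartSU N Λ) S = Set.pi univ fun _ : ↥Λ => closedBall (0 : ChartSU N) S := by
  rw [closedBall_pi _ hS]
  rfl

/-- a point of the window has every bond coordinate in the one-bond ball. [folklore] -/
theorem norm_apply_le_of_mem_closedBall {S : ℝ} {x : BlockChartSU N Λ} (hx : x ∈ closedBall (0 : BlockChartSU N Λ) S)
    (b : ↥Λ) : ‖x b‖ ≤ S :=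
  (norm_le_pi_norm x b).trans (mem_closedBall_zero_iff.mp hx)

/-- a closed ball about the origin of a real normed space is STAR-SHAPED about the centre. [folklore] -/
theorem smul_mem_closedBall_zero {E : Type*} [SeminormedAddCommGroup E] [NormedSpace ℝ E] {S : ℝ} {x : E}
    (hx : x ∈ closedBall (0 : E) S) {c : ℝ} (hc0 : 0 ≤ c) (hc1 : c ≤ 1) : c • x ∈ closedBall (0 : E) S := by
  rw [mem_closedBall_zero_iff] at hx ⊢
  rw [norm_smul, Real.norm_eq_abs, abs_of_nonneg hc0]
  calc c * ‖x‖ ≤ 1 * ‖x‖ := mul_le_mul_of_nonneg_right hc1 (norm_nonneg _)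
    _ ≤ S := by rw [one_mul]; exact hx

/-- THE BLOCK CHART WEIGHT built from a one-bond weight `J₁`: `1_{‖x‖ ≤ S} · ∏_b J₁ (x b)`. [folklore] -/
def chartWeightSU (S : ℝ) (J₁ : ChartSU N → ℝ≥0∞) : BlockChartSU N Λ → ℝ≥0∞ :=
  (closedBall (0 : BlockChartSU N Λ) S).indicator fun x => ∏ b, J₁ (x b)

/-- the block chart weight is measurable when `J₁` is. [folklore] -/
theorem measurable_chartWeightSU (S : ℝ) {J₁ : ChartSU N → ℝ≥0∞} (hJ₁ : Measurable J₁) :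
    Measurable (chartWeightSU Λ S J₁) :=
  (Finset.measurable_prod _ fun b _ => hJ₁.comp (measurable_pi_apply b)).indicator measurableSet_closedBall

/-- a point where the block chart weight is non-zero lies in the window. [folklore] -/
theorem mem_closedBall_of_chartWeightSU_ne_zero {S : ℝ} {J₁ : ChartSU N → ℝ≥0∞} {x : BlockChartSU N Λ}
    (h : chartWeightSU Λ S J₁ x ≠ 0) : x ∈ closedBall (0 : BlockChartSU N Λ) S := by
  by_contra hx
  exact h (indicator_of_notMem hx _)

/-- on the window the block chart weight is the product of the one-bond indicator weights. [folklore] -/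
theorem chartWeightSU_eq_prod_indicator {S : ℝ} (hS : 0 ≤ S) (J₁ : ChartSU N → ℝ≥0∞) (x : BlockChartSU N Λ) :
    chartWeightSU Λ S J₁ x = ∏ b, (closedBall (0 : ChartSU N) S).indicator J₁ (x b) := by
  unfold chartWeightSU
  by_cases hx : x ∈ closedBall (0 : BlockChartSU N Λ) S
  · rw [indicator_of_mem hx]
    refine Finset.prod_congr rfl fun b _ => ?_
    rw [indicator_of_mem (mem_closedBall_zero_iff.mpr (norm_apply_le_of_mem_closedBall Λ hx b))]
  · rw [indicator_of_notMem hx]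
    obtain ⟨b, hb⟩ : ∃ b, x b ∉ closedBall (0 : ChartSU N) S := by
      by_contra h
      apply hx
      rw [closedBall_eq_pi Λ hS]
      exact fun b _ => (not_exists_not.mp h) b
    exact (Finset.prod_eq_zero (Finset.mem_univ b) (indicator_of_notMem hb _)).symm

/-- **A CENTRE-MONOTONE ONE-BOND WEIGHT GIVES A COST-FREE BLOCK CHART WEIGHT.**  If `J₁` does not decrease towards
the centre on the one-bond ball (`J₁ v ≤ J₁ (c • v)` for `‖v‖ ≤ S`, `0 ≤ c ≤ 1`), then the block chart weight
`1_{‖x‖ ≤ S} · ∏_b J₁ (x b)` does not decrease along the contraction `x ↦ e^{−a} x`, `a ≥ 0` — the hypothesis `hJ` of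
`ShellMeasureScalingLocal.slotAntiConcentration_of_coreMap_mul`. [folklore] -/
theorem chartWeightSU_le_smul {S : ℝ} {J₁ : ChartSU N → ℝ≥0∞}
    (hJ₁ : ∀ v : ChartSU N, ‖v‖ ≤ S → ∀ c : ℝ, 0 ≤ c → c ≤ 1 → J₁ v ≤ J₁ (c • v)) {a : ℝ} (ha : 0 ≤ a)
    (x : BlockChartSU N Λ) :
    chartWeightSU Λ S J₁ x ≤ chartWeightSU Λ S J₁ (Real.exp (-a) • x) := by
  have hc0 : 0 ≤ Real.exp (-a) := (Real.exp_pos _).le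
  have hc1 : Real.exp (-a) ≤ 1 := by rw [Real.exp_le_one_iff]; linarith
  unfold chartWeightSU
  by_cases hx : x ∈ closedBall (0 : BlockChartSU N Λ) S
  · rw [indicator_of_mem hx, indicator_of_mem (smul_mem_closedBall_zero hx hc0 hc1)]
    refine Finset.prod_le_prod' fun b _ => ?_
    rw [Pi.smul_apply]
    exact hJ₁ (x b) (norm_apply_le_of_mem_closedBall Λ hx b) _ hc0 hc1
  · rw [indicator_of_notMem hx]
    exact bot_le

end Window

/-! ## §3 (v1.1) The chart dimension in numbers: `d_N = N² − 1`, so `dim (BlockChartSU N Λ) = #Λ·(N² − 1)` -/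

section Dimension

/-- the tree's `lieSU (Fin N)` IS Mathlib's `skewAdjoint ⊓ ker tr` over `ℝ` (the submodule whose real dimension the
tree's `RepLieAlgebraUnitary.finrank_skewAdjoint_inf_ker_trace` computes). [folklore] -/
theorem lieSU_eq_skewAdjoint_inf_ker (N : ℕ) :
    lieSU (Fin N) = skewAdjoint.submodule ℝ (Matrix (Fin N) (Fin N) ℂ) ⊓
      LinearMap.ker (Matrix.traceLinearMap (Fin N) ℝ ℂ) := by
  ext X
  rw [mem_lieSU_iff, Submodule.mem_inf, LinearMap.mem_ker, Matrix.traceLinearMap_apply]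
  exact Iff.rfl

/-- **THE CHART DIMENSION IN NUMBERS**: `d_N = dim_ℝ 𝔰𝔲(N) = N² − 1`. [folklore] -/
theorem dimSU_eq (N : ℕ) : dimSU N = N ^ 2 - 1 := by
  unfold dimSU
  rw [lieSU_eq_skewAdjoint_inf_ker,
    Literature.MathematicalPhysics.QuantumLattice.finrank_skewAdjoint_inf_ker_trace, Fintype.card_fin]

variable {P : Params} {j : ℕ}

/-- … so the block chart space through `Λ` has dimension `#Λ · (N² − 1)` — the `dim E` entering the engine's constant
`(dim E + B_f)·a ≤ D·ρ` for `G = SU(N)`, in numbers. [folklore] -/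
theorem finrank_blockChart_eq (Λ : Finset (PBond P j)) :
    Module.finrank ℝ (BlockChartSU N Λ) = Λ.card * (N ^ 2 - 1) := by
  rw [finrank_blockChart, dimSU_eq]

end Dimension

end Summit.QuantumFields.BalabanUV.T4Continuum.ShellMeasureExpChartSUN

end
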